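import Summits.QuantumFields.YangMills.Theorems.BalabanUVNodesN14AtRecord

/-!
# BalabanUVNodes ∕ node N14 = NE1′ — FAN-OUT §N14 row s3 («SIBLING REDUCTION») LOCATED, AND ITS HONEST RESIDUE TYPED: the TWO-RUN
# young half of the residual road (`TiltedMeanCrossover.YoungInfluenceRate`) BY NAME from node U3's letters (`N18At` = NE5, `N22At` = NE9),
# and the capstone `∃ η, TiltedMeanMatching … η ∧ Summable η` read from `RatesAt D R` at N14 · N18 · N22

Cell `pub-ymgap`, HUMAN RULINGS D-0062∕D-0088, director-ym R141 (C) WIDER STRATEGY FAN-OUT, seat `pub-ymgap-dag-n14-e` (strategy s3 =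
ALTERNATIVE CURRENCY), generation 0; route `Summits/QuantumFields/YangMills/Theses/BalabanUVNodes.lean` rev 6 (K3 `SpineGivenEndpointR11`,
`--supports stmt-QuantumFields-19676`); venue ruling R424.  THEOREMS ONLY; imports seat n14-a's `BalabanUVNodesN14AtRecord` (through it
`BalabanUVNodesSpineRates` — `U3Carriers`, `RateCarriers`, `N14At`, `N18At`, `N22At`, `RatesAt` — and `BalabanUVNodesN14TiltedMatching` —
`tiltedMeanMatching_summable_of_n14` — and the gaps seat ne1's `Spine/NE1p/TiltedMeanCrossover` — `ScaleLedger`, `YoungInfluenceRate`) ONLY;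
modifies nothing; every cited lemma is used BY NAME.

THE ROW AND ITS VERDICT.  FAN-OUT v1.1 §N14 s3: «NE1′ from NE5 (N18) output rates + NE3 (N16) via the `RatesAt D R` link — i.e. type
"NE5 ∧ NE3 ∧ tilted-analyticity ⇒ NE1′" as one theorem at the spine carriers; honest if the implication is real».  IT IS NOT REAL:
(a) `YMDAG.UVSplit.RateCarriers` has INDEPENDENT fields `ne1 ∕ ne2 ∕ ne3 ∕ u3` and `N14At c := DressedStabilityStrict c.𝒯 c.Λ` reads `ne1`
only, so `R.ne1 := ⟨Unit, growingTower, 1⟩` (`DressedRootStrict.not_dressedStabilityStrict_growingTower`) beside ANY sibling carriers refutes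
the carrier-level implication (seat n14-d's `BalabanUVNodesN14RecordCensus` §4 is the kernel witness of record — not repeated here);
(b) ORIENTATION: NE5 (`T4OutputRate.NE5`) is a TWO-RUN rate with factor `θ^{scale X}`, small for YOUNG slots, whereas NE1′'s class
`twoRate A₀ ρ₁ τ K j k` with the strict product `Λρ₁τ < 1` is a ONE-RUN size decaying in the AGE `K − j`, i.e. for OLD births;
(c) the tree already records which half is whose: `TiltedMeanCrossover.tiltedMeanMatching_of_budget` builds N14's residual binder
`DressedMGFForm.TiltedMeanMatching` from TWO ONE-RUN `OldInfluenceBudget`s — N14's content, `N14TiltedMatching.oldInfluenceBudget_of_n14`,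
letter `a = ρ₁τΛ < 1` — AND ONE TWO-RUN `YoungInfluenceRate` («NE5∕NE9's currency»): complementary halves of the crossover
`Σ_{j+n=K} min(a^n, θ^jΛ^n)`, neither implying the other; (d) tilted analyticity is already cashed on that road (`DressedMGFForm`: the MGF
form makes the residual a first-moment statement; `B16Ineq175Tilted` §5 ∕ `BalabanUVNodesN14TiltedAnalytic` identify the (1.75)ₜ currency
with `tiltedMean`) — it buys μ-uniformity, not age decay.

WHAT s3 REDUCES TO (dag-lead DEDUP-149, pub-ymgap INBOX 2026-08-26T15:19:44Z, asked for this sentence).  On road (ii) N14's residual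
binder `TiltedMeanMatching` = N14's OWN old half (`DressedStabilityStrict` — one-run, age decay, NOT sibling currency; FAN-OUT §N14 s3 footnote
«sibling reduction not real as typed», seats n14-c ∕ n14-d ∕ this header) + the YOUNG half `YoungInfluenceRate` (sibling currency: N18 ∕ N22
BY NAME below, N16 ∕ N17 through two displayed brackets) + NODE O's ledger ∕ identifications ∕ census.  Nothing of NE1′ itself is reduced
to its siblings.

WHAT IS REAL, AND TYPED HERE.  The young half IS sibling currency, and its displayed binder `hY : YoungInfluenceRate …` of
`N14TiltedMatching.tiltedMeanMatching_summable_of_n14` had NO producer in the tree.  This file feeds it BY NAME from node U3: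
* §1 `ne5_mono_rate` (rate∕constant worsening of NE5) and **`youngInfluenceRate_of_u3Letters`** [bookkeeping] over generic
  `T4OutputRate.Carriers`: `NE9 EA W κ Λ9` ∧ `LipBackground EA W κ CU` ∧ `NE5 EA EB W κ θ C₅` (node U3's three letters), an
  IDENTIFICATION of the consumer's ledger slots with U3 domains (scale-aligned), the TWO-RUN DOMINATION `|ΔB X − ΔA X| ≤ wt X ·
  |EA gA UA X′ − EB gB UB X′|` (the two-run twin of n14-a's one-run domination by booked sizes; NODE O's, displayed), the argument
  bracket at rate `CU·gauge(UA, transport UB) ≤ a·θ^j` (NE3's consumer shape `BackgroundsClose` WITH RATE — N16's liaison output on road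
  (i), displayed), the coupling bracket at rate `Σ_{i<j} Λ9 j i |gA i − gB i| ≤ b·θ^j` (node U2's matching through NE9's moduli — N17 ∕
  `InjectedRate` on road (i), displayed) and the census `T4RecentScale.Multiplicity (wf K τ) (sc K) (wt K τ) Cw vol Λ K` give
  `YoungInfluenceRate l₀ T Bad wf sc ΔA ΔB vol (Cw·(a + b + C₅)) θ Λ` — per slot `T4OutputRate.u3_threeBrackets` BY NAME, then the census.
* §2 **`youngInfluenceRate_of_n18At_n22At`** [bookkeeping] AT `u : U3Carriers`: `N18At u` and `N22At u` BY NAME (run B's functional is the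
  first-coupling family read through a selector `bsel`, as in `N19RateEdge.ne5_of_n18At`), `LipBackground u.EA u.W u.κ CU` (the bracket
  (T), displayed on road (i) too), the identifications of §1 on `u.C`, brackets at any rate `ρ ≥ u.θ`, letter signs ⇒ the young rate at
  `(Cw·(a + b + u.C₅), ρ, Λ)`.
* §3 **`tiltedMeanMatching_summable_of_n14At_n18At_n22At`** and **`tiltedMeanMatching_summable_of_ratesAt`** [bookkeeping] — THE CAPSTONE
  ON ROAD (ii): for `R : RateCarriers N`, `N14At R.ne1` (the two one-run old budgets, n14-a's `tiltedMeanMatching_summable_of_n14` BY NAME)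
  and `N18At R.u3 ∧ N22At R.u3` (§2's young rate), resp. `RatesAt D R` read at `.1`, `.2.2.2.2.1`, `.2.2.2.2.2`, with the `ScaleLedger`, the
  one-run and two-run identifications, ONE census at N14's rate `R.ne1.Λ`, `LipBackground`, the two brackets at a rate `ρ ∈ [u.θ, 1[`,
  `ρ ≤ R.ne1.Λ`, `Summable w` ⇒ `∃ η, TiltedMeanMatching l₀ T Bad F ν F′ ν′ η ∧ Summable η` — EXACTLY the pair
  `DressedMGFForm.hybridNE7_of_mgfForm` consumes; the road-(ii) analogue of n19-a's `N19RateEdgeByName.rateEdge_of_linkReading_byName`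
  (road (i), `NE7.Core` currency).  N16 and N17 enter ONLY through the two displayed brackets (their road-(i) producers
  `N19InEdgesAtRecord.ne3Liaison_of_covRoot` ∕ `injectedRate_of_n17At_readOutAt` are not restated).
* §4 `youngInfluenceRate_toy` [decided toy]: §1's binder list is jointly inhabited with a non-trivial rate (slots at every scale, run B's
  influences `c·θ^X` realised AS NE5's discrepancy of two explicit functionals, domination with equality).

HONEST FRAMING.  Count-neutral kernel bookkeeping BY NAME over hypothesis SHAPES; 0 `def`, 0 `sorry`, standard axioms; NE1′, NE5, NE9, NE3,
NE7 NOT PRINTED ∕ NOT proved; nothing of Bałaban's densities is asserted or instantiated; the identifications (which ledger realises the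
tilted first moments, which U3 domain and backgrounds a slot reads), the dominations, the brackets and the census are NODE O's ∕ other rows'
DISPLAYED binders discharged by nobody; N14 NOT discharged; `RateCarriers` are PARAMETERS (no carrier of record exists in the tree).  One
finite four-torus at fixed ε, Bałaban as printed elsewhere — NOT infinite volume, NOT OS on ℝ⁴, NOT a mass gap, NOT Clay.
-/

noncomputable section

namespace YMDAG.N14YoungRate

open Finset MeasureTheory
open scoped BigOperators
open Literature.MathematicalPhysics.QuantumFieldTheory.Balaban1983to89
open Literature.MathematicalPhysics.QuantumFieldTheory.Balaban1983to89.T4OutputRate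
  (Carriers Functional NE5 NE9 LipBackground u3_threeBrackets)
open Literature.MathematicalPhysics.QuantumFieldTheory.Balaban1983to89.T4RecentScale (Multiplicity)
open Summit.QuantumFields.BalabanUV.T4Continuum.NE1p.DressedRoot (DressedTower DressedStabilityStrict)
open Summit.QuantumFields.BalabanUV.T4Continuum.NE1p.DressedMGFForm (tiltedMean TiltedMeanMatching)
open Summit.QuantumFields.BalabanUV.T4Continuum.NE1p.TiltedMeanCrossover (ScaleLedger YoungInfluenceRate)
open YMDAG.UVSplit (U3Carriers RateCarriers N14At N18At N22At RatesAt)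

/-! ## §1 Node U3's three letters ⇒ the two-run young rate of the residual road (generic carriers) -/

section Generic

variable {C : Carriers}

/-- **NE5 IS MONOTONE IN ITS RATE AND CONSTANT** [folklore]: `0 ≤ θ ≤ θ′`, `0 ≤ C₅ ≤ C₅′` turn `NE5 EA EB W κ θ C₅` into
`NE5 EA EB W κ θ′ C₅′` (`θ^j ≤ θ′^j`). -/
theorem ne5_mono_rate {EA : Functional C C.BgA} {EB : Functional C C.BgB} {W : Set (ℕ → ℝ)} {κ θ θ' C₅ C₅' : ℝ}
    (h : NE5 EA EB W κ θ C₅) (hθ : 0 ≤ θ) (hθθ' : θ ≤ θ') (hC₅ : 0 ≤ C₅) (hC₅' : C₅ ≤ C₅') : NE5 EA EB W κ θ' C₅' := by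
  intro g hg U X
  refine (h g hg U X).trans (mul_le_mul_of_nonneg_right ?_ (Real.exp_pos _).le)
  exact mul_le_mul hC₅' (pow_le_pow_left₀ hθ hθθ' _) (pow_nonneg hθ _) (hC₅.trans hC₅')

/-- **ONE SLOT** [bookkeeping]: node U3's three letters (`T4OutputRate.u3_threeBrackets` BY NAME) with the argument bracket and the
coupling bracket at rate `θ^j` (`j = scale X`), `κ ≥ 0` (the tree decay `e^{−κd(X)} ≤ 1` is dropped) and letter signs give
`|EA gA UA X − EB gB UB X| ≤ (a + b + C₅)·θ^j`; a quantity dominated by `wt·|EA gA UA X − EB gB UB X|` is then `≤ wt·((a + b + C₅)·θ^j)`.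
[folklore] -/
theorem abs_sub_le_of_dom_threeBrackets {W : Set (ℕ → ℝ)} {EA : Functional C C.BgA} {EB : Functional C C.BgB}
    {κ θ C₅ : ℝ} {Λ9 : ℕ → ℕ → ℝ} {CU : (ℕ → ℝ) → ℕ → ℝ}
    (h9 : NE9 EA W κ Λ9) (hU : LipBackground EA W κ CU) (h5 : NE5 EA EB W κ θ C₅) (hκ : 0 ≤ κ)
    {gA gB : ℕ → ℝ} (hgA : gA ∈ W) (hgB : gB ∈ W) (UA : C.BgA) (UB : C.BgB) (X : C.Dom) (hCU : 0 ≤ CU gA (C.scale X))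
    {a b : ℝ} (ha : CU gA (C.scale X) * C.gauge UA (C.transport UB) ≤ a * θ ^ C.scale X)
    (hb : ∑ i ∈ range (C.scale X), Λ9 (C.scale X) i * |gA i - gB i| ≤ b * θ ^ C.scale X)
    (ha0 : 0 ≤ a) (hb0 : 0 ≤ b) (hC₅ : 0 ≤ C₅) (hθ : 0 ≤ θ)
    {x y wt : ℝ} (hwt : 0 ≤ wt) (hdom : |y - x| ≤ wt * |EA gA UA X - EB gB UB X|) :
    |y - x| ≤ wt * ((a + b + C₅) * θ ^ C.scale X) := by
  have h3 := u3_threeBrackets h9 hU h5 hgA hgB (le_refl (C.gauge UA (C.transport UB))) X hCU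
  have hexp1 : Real.exp (-(κ * C.d X)) ≤ 1 := by
    rw [Real.exp_le_one_iff, neg_nonpos]
    exact mul_nonneg hκ (C.d_nonneg X)
  have hsum : CU gA (C.scale X) * C.gauge UA (C.transport UB)
      + (∑ i ∈ range (C.scale X), Λ9 (C.scale X) i * |gA i - gB i|) + C₅ * θ ^ C.scale X
      ≤ (a + b + C₅) * θ ^ C.scale X := by nlinarith
  have hnn : 0 ≤ (a + b + C₅) * θ ^ C.scale X := mul_nonneg (by linarith) (pow_nonneg hθ _)
  have hE : |EA gA UA X - EB gB UB X| ≤ (a + b + C₅) * θ ^ C.scale X :=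
    calc |EA gA UA X - EB gB UB X|
        ≤ (CU gA (C.scale X) * C.gauge UA (C.transport UB)
            + (∑ i ∈ range (C.scale X), Λ9 (C.scale X) i * |gA i - gB i|) + C₅ * θ ^ C.scale X)
            * Real.exp (-(κ * C.d X)) := h3
      _ ≤ ((a + b + C₅) * θ ^ C.scale X) * Real.exp (-(κ * C.d X)) :=
          mul_le_mul_of_nonneg_right hsum (Real.exp_pos _).le
      _ ≤ ((a + b + C₅) * θ ^ C.scale X) * 1 := mul_le_mul_of_nonneg_left hexp1 hnn
      _ = (a + b + C₅) * θ ^ C.scale X := mul_one _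
  exact hdom.trans (mul_le_mul_of_nonneg_left hE hwt)

variable {ι D : Type*} [DecidableEq ι] {l₀ vol : ℝ} {T : ℕ → Finset ι} {Bad : ℕ → ℝ → Finset ι} {wf : ℕ → ι → Finset D}
  {sc : ℕ → D → ℕ} {ΔA ΔB : ℕ → ℝ → ι → ℝ → D → ℝ}

/-- **ONE SLICE** [folklore]: per-slot domination `|ΔB X − ΔA X| ≤ wt X·σ` on the scale-`j` slice (`σ ≥ 0`) and the slice census
`Σ_{sc X = j} wt X ≤ M` give `Σ_{sc X = j} |ΔB X − ΔA X| ≤ σ·M`. -/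
theorem slice_abs_sub_le_of_dom (wf : Finset D) (sc : D → ℕ) (ΔA ΔB wt : D → ℝ) (j : ℕ) {σ M : ℝ}
    (hdom : ∀ X ∈ wf, sc X = j → |ΔB X - ΔA X| ≤ wt X * σ) (hσ : 0 ≤ σ) (hM : ∑ X ∈ wf with sc X = j, wt X ≤ M) :
    ∑ X ∈ wf with sc X = j, |ΔB X - ΔA X| ≤ σ * M := by
  calc ∑ X ∈ wf with sc X = j, |ΔB X - ΔA X| ≤ ∑ X ∈ wf with sc X = j, wt X * σ :=
        sum_le_sum fun X hX => by
          obtain ⟨hXw, hXj⟩ := mem_filter.mp hX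
          exact hdom X hXw hXj
    _ = σ * ∑ X ∈ wf with sc X = j, wt X := by rw [mul_sum]; exact sum_congr rfl fun X _ => mul_comm _ _
    _ ≤ σ * M := mul_le_mul_of_nonneg_left hM hσ

/-- **NODE U3's THREE LETTERS ⇒ THE YOUNG RATE** [bookkeeping].  Data: the consumer's classes `T`, bad classes `Bad`, slot ledgers
`wf K τ` with scales `sc K`, the two runs' slot influences `ΔA`, `ΔB` on their tilted first moments, volume weights `wt K τ X ≥ 0`, census
constants `Cw, vol` at rate `Λ`; node U3's carriers `C` with run A's functional `EA`, run B's `EB`, window `W`, decay `κ ≥ 0`; the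
letters `NE9 EA W κ Λ9`, `LipBackground EA W κ CU` (`CU ≥ 0`), `NE5 EA EB W κ θ C₅`.  IDENTIFICATION (NODE O, displayed): for every
`(K, t, τ, s)` a map `δ` of the slots into U3 domains with `scale (δ X) = sc K X`, coupling tables `gA K, gB K ∈ W`, backgrounds
`UA`, `UB`, and the TWO-RUN DOMINATION `|ΔB X − ΔA X| ≤ wt X · |EA (gA K) (UA X) (δ X) − EB (gB K) (UB X) (δ X)|`; BRACKETS AT RATE
(other rows', displayed): `CU (gA K) j · gauge (UA X) (transport (UB X)) ≤ a·θ^j` and `Σ_{i<j} Λ9 j i |gA K i − gB K i| ≤ b·θ^j`; CENSUS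
`Multiplicity (wf K τ) (sc K) (wt K τ) Cw vol Λ K`; signs `0 ≤ a, b, C₅, θ`.  THEN
`YoungInfluenceRate l₀ T Bad wf sc ΔA ΔB vol (Cw·(a + b + C₅)) θ Λ`. [folklore] -/
theorem youngInfluenceRate_of_u3Letters {W : Set (ℕ → ℝ)} {EA : Functional C C.BgA} {EB : Functional C C.BgB}
    {κ θ C₅ : ℝ} {Λ9 : ℕ → ℕ → ℝ} {CU : (ℕ → ℝ) → ℕ → ℝ}
    (h9 : NE9 EA W κ Λ9) (hU : LipBackground EA W κ CU) (h5 : NE5 EA EB W κ θ C₅) (hκ : 0 ≤ κ)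
    (wt : ℕ → ι → D → ℝ) (hwt : ∀ K τ, ∀ X ∈ wf K τ, 0 ≤ wt K τ X) {Cw Λ : ℝ}
    (hM : ∀ K, ∀ τ ∈ T K, Multiplicity (wf K τ) (sc K) (wt K τ) Cw vol Λ K)
    (δ : ∀ (K : ℕ) (t : ℝ) (τ : ι) (s : ℝ), D → C.Dom) (hδ : ∀ K t τ s, ∀ X ∈ wf K τ, C.scale (δ K t τ s X) = sc K X)
    (gA gB : ℕ → ℕ → ℝ) (hgA : ∀ K, gA K ∈ W) (hgB : ∀ K, gB K ∈ W) (hCU : ∀ K j, 0 ≤ CU (gA K) j)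
    (UA : ∀ (K : ℕ) (t : ℝ) (τ : ι) (s : ℝ), D → C.BgA) (UB : ∀ (K : ℕ) (t : ℝ) (τ : ι) (s : ℝ), D → C.BgB)
    (hdom : ∀ K (t : ℝ), |t| ≤ l₀ → ∀ τ ∈ T K \ Bad K t, ∀ s : ℝ, |s| ≤ l₀ → ∀ X ∈ wf K τ,
      |ΔB K t τ s X - ΔA K t τ s X| ≤
        wt K τ X * |EA (gA K) (UA K t τ s X) (δ K t τ s X) - EB (gB K) (UB K t τ s X) (δ K t τ s X)|)
    {a b : ℝ}
    (harg : ∀ K (t : ℝ), |t| ≤ l₀ → ∀ τ ∈ T K \ Bad K t, ∀ s : ℝ, |s| ≤ l₀ → ∀ X ∈ wf K τ,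
      CU (gA K) (sc K X) * C.gauge (UA K t τ s X) (C.transport (UB K t τ s X)) ≤ a * θ ^ sc K X)
    (hcpl : ∀ K, ∀ j ≤ K, ∑ i ∈ range j, Λ9 j i * |gA K i - gB K i| ≤ b * θ ^ j)
    (ha0 : 0 ≤ a) (hb0 : 0 ≤ b) (hC₅ : 0 ≤ C₅) (hθ : 0 ≤ θ) :
    YoungInfluenceRate l₀ T Bad wf sc ΔA ΔB vol (Cw * (a + b + C₅)) θ Λ := by
  intro K t ht τ hτ s hs j hj
  have hτT : τ ∈ T K := (mem_sdiff.mp hτ).1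
  have hσ : 0 ≤ (a + b + C₅) * θ ^ j := mul_nonneg (by linarith) (pow_nonneg hθ _)
  have hdom' : ∀ X ∈ wf K τ, sc K X = j → |ΔB K t τ s X - ΔA K t τ s X| ≤ wt K τ X * ((a + b + C₅) * θ ^ j) := by
    intro X hX hXj
    have hscX : C.scale (δ K t τ s X) = j := (hδ K t τ s X hX).trans hXj
    have h := abs_sub_le_of_dom_threeBrackets h9 hU h5 hκ (hgA K) (hgB K) (UA K t τ s X) (UB K t τ s X) (δ K t τ s X)
      (by rw [hscX, ← hXj]; exact hCU K (sc K X)) (a := a) (b := b)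
      (by rw [hscX, ← hXj]; exact harg K t ht τ hτ s hs X hX)
      (by rw [hscX]; exact hcpl K j hj) ha0 hb0 hC₅ hθ (hwt K τ X hX) (hdom K t ht τ hτ s hs X hX)
    rw [hscX] at h
    exact h
  calc ∑ X ∈ wf K τ with sc K X = j, |ΔB K t τ s X - ΔA K t τ s X|
      ≤ (a + b + C₅) * θ ^ j * (Cw * vol * Λ ^ (K - j)) :=
        slice_abs_sub_le_of_dom (wf K τ) (sc K) (ΔA K t τ s) (ΔB K t τ s) (wt K τ) j hdom' hσ (hM K τ hτT j hj)
    _ = vol * (Cw * (a + b + C₅) * (θ ^ j * Λ ^ (K - j))) := by ring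

/-- **THE YOUNG RATE IS MONOTONE IN ITS CONSTANT** [folklore]: `C ≤ C′` with `vol ≥ 0`, `θ, Λ ≥ 0`. -/
theorem youngInfluenceRate_mono_const {C' C'' θ Λ : ℝ} (h : YoungInfluenceRate l₀ T Bad wf sc ΔA ΔB vol C' θ Λ)
    (hvol : 0 ≤ vol) (hθ : 0 ≤ θ) (hΛ : 0 ≤ Λ) (hle : C' ≤ C'') : YoungInfluenceRate l₀ T Bad wf sc ΔA ΔB vol C'' θ Λ :=
  fun K t ht τ hτ s hs j hj => (h K t ht τ hτ s hs j hj).trans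
    (mul_le_mul_of_nonneg_left (mul_le_mul_of_nonneg_right hle (mul_nonneg (pow_nonneg hθ _) (pow_nonneg hΛ _))) hvol)

end Generic

/-! ## §2 At node U3's carriers: `N18At` and `N22At` BY NAME -/

section AtU3

variable {ι D : Type*} [DecidableEq ι] {l₀ vol : ℝ} {T : ℕ → Finset ι} {Bad : ℕ → ℝ → Finset ι} {wf : ℕ → ι → Finset D}
  {sc : ℕ → D → ℕ} {ΔA ΔB : ℕ → ℝ → ι → ℝ → D → ℝ}

/-- **`N18At u ∧ N22At u` ⇒ THE YOUNG RATE AT THE U3 CARRIERS** [bookkeeping].  Node U3's carriers `u` with `N18At u` (NE5 at every member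
of run B's first-coupling family) and `N22At u` (NE9 ∧ fading memory, run A) BY NAME; run B's functional is the family read through a
first-coupling selector `bsel` with `0 < bsel s ≤ u.γ` on the window (as in `N19RateEdge.ne5_of_n18At`); the bracket (T)
`LipBackground u.EA u.W u.κ CU` (`CU ≥ 0`); the identification ∕ two-run domination ∕ brackets ∕ census of `youngInfluenceRate_of_u3Letters`
on `u.C`, the brackets at a rate `ρ ≥ u.θ`; letter signs `0 ≤ u.θ, u.C₅, u.κ`.  THEN
`YoungInfluenceRate l₀ T Bad wf sc ΔA ΔB vol (Cw·(a + b + u.C₅)) ρ Λ`.  NE3 (N16) and NE4 (N17) enter only through the two displayed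
brackets. [folklore] -/
theorem youngInfluenceRate_of_n18At_n22At (u : U3Carriers) (h18 : N18At u) (h22 : N22At u)
    (bsel : (ℕ → ℝ) → ℝ) (hb : ∀ s ∈ u.W, 0 < bsel s ∧ bsel s ≤ u.γ)
    {CU : (ℕ → ℝ) → ℕ → ℝ} (hU : LipBackground u.EA u.W u.κ CU)
    (hθ : 0 ≤ u.θ) (hC₅ : 0 ≤ u.C₅) (hκ : 0 ≤ u.κ) {ρ : ℝ} (hθρ : u.θ ≤ ρ)
    (wt : ℕ → ι → D → ℝ) (hwt : ∀ K τ, ∀ X ∈ wf K τ, 0 ≤ wt K τ X) {Cw Λ : ℝ}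
    (hM : ∀ K, ∀ τ ∈ T K, Multiplicity (wf K τ) (sc K) (wt K τ) Cw vol Λ K)
    (δ : ∀ (K : ℕ) (t : ℝ) (τ : ι) (s : ℝ), D → u.C.Dom) (hδ : ∀ K t τ s, ∀ X ∈ wf K τ, u.C.scale (δ K t τ s X) = sc K X)
    (gA gB : ℕ → ℕ → ℝ) (hgA : ∀ K, gA K ∈ u.W) (hgB : ∀ K, gB K ∈ u.W) (hCU : ∀ K j, 0 ≤ CU (gA K) j)
    (UA : ∀ (K : ℕ) (t : ℝ) (τ : ι) (s : ℝ), D → u.C.BgA) (UB : ∀ (K : ℕ) (t : ℝ) (τ : ι) (s : ℝ), D → u.C.BgB)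
    (hdom : ∀ K (t : ℝ), |t| ≤ l₀ → ∀ τ ∈ T K \ Bad K t, ∀ s : ℝ, |s| ≤ l₀ → ∀ X ∈ wf K τ,
      |ΔB K t τ s X - ΔA K t τ s X| ≤
        wt K τ X * |u.EA (gA K) (UA K t τ s X) (δ K t τ s X) - u.EB (bsel (gB K)) (gB K) (UB K t τ s X) (δ K t τ s X)|)
    {a b : ℝ}
    (harg : ∀ K (t : ℝ), |t| ≤ l₀ → ∀ τ ∈ T K \ Bad K t, ∀ s : ℝ, |s| ≤ l₀ → ∀ X ∈ wf K τ,
      CU (gA K) (sc K X) * u.C.gauge (UA K t τ s X) (u.C.transport (UB K t τ s X)) ≤ a * ρ ^ sc K X)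
    (hcpl : ∀ K, ∀ j ≤ K, ∑ i ∈ range j, u.Λ j i * |gA K i - gB K i| ≤ b * ρ ^ j)
    (ha0 : 0 ≤ a) (hb0 : 0 ≤ b) :
    YoungInfluenceRate l₀ T Bad wf sc ΔA ΔB vol (Cw * (a + b + u.C₅)) ρ Λ := by
  -- NE5 for run B's selected family (`N19RateEdge.ne5_of_n18At`, inlined), worsened to the rate `ρ`
  have h5 : NE5 u.EA (fun s => u.EB (bsel s) s) u.W u.κ u.θ u.C₅ := fun s hs U X => h18 (bsel s) (hb s hs).1 (hb s hs).2 s hs U X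
  have h5ρ : NE5 u.EA (fun s => u.EB (bsel s) s) u.W u.κ ρ u.C₅ := ne5_mono_rate h5 hθ hθρ hC₅ le_rfl
  exact youngInfluenceRate_of_u3Letters h22.1 hU h5ρ hκ wt hwt hM δ hδ gA gB hgA hgB hCU UA UB hdom harg hcpl ha0 hb0 hC₅
    (hθ.trans hθρ)

end AtU3

/-! ## §3 The capstone on road (ii): `RatesAt D R` at N14 · N18 · N22 ⇒ `∃ η, TiltedMeanMatching … η ∧ Summable η` -/

section Capstone

variable {N : ℕ} [NeZero N] {ι D : Type*} [DecidableEq ι] {Ω Ω' : ℕ → Type*} [∀ K, MeasurableSpace (Ω K)]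
  [∀ K, MeasurableSpace (Ω' K)] {l₀ vol : ℝ} {T : ℕ → Finset ι} {Bad : ℕ → ℝ → Finset ι} {F : ∀ K, Ω K → ℝ}
  {ν : ∀ K, ι → Measure (Ω K)} {F' : ∀ K, Ω' K → ℝ} {ν' : ∀ K, ι → Measure (Ω' K)} {wf : ℕ → ι → Finset D}
  {sc : ℕ → D → ℕ} {bA bB : ℕ → ℝ → ι → ℝ → ℝ} {ΔA ΔB : ℕ → ℝ → ι → ℝ → D → ℝ} {w : ℕ → ℝ}

omit [NeZero N] in
/-- **N14 ∧ N18 ∧ N22 AT THE RATE CARRIERS ⇒ THE RESIDUAL BINDER WITH A SUMMABLE MAJORANT** [bookkeeping].  For `R : RateCarriers N`: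
`N14At R.ne1` serves BOTH runs' one-run old budgets (n14-a's `tiltedMeanMatching_summable_of_n14` BY NAME, with its `ScaleLedger`, volume
weights, ONE census `Multiplicity … Cw vol R.ne1.Λ K` at N14's rate, and the two one-run identifications ∕ dominations by booked sizes of
`R.ne1.𝒯`), while `N18At R.u3 ∧ N22At R.u3` serve the young rate (§2: selector `bsel`, bracket (T) `LipBackground R.u3.EA R.u3.W R.u3.κ CU`,
the two-run identification ∕ domination on `R.u3.C`, the two brackets at a rate `ρ` with `R.u3.θ ≤ ρ`, `0 < ρ < 1`, `ρ ≤ R.ne1.Λ`, letter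
signs); base widths `Summable w`, `vol ≥ 0`.  THEN `∃ η, TiltedMeanMatching l₀ T Bad F ν F′ ν′ η ∧ Summable η` — the pair
`DressedMGFForm.hybridNE7_of_mgfForm` consumes. [folklore] -/
theorem tiltedMeanMatching_summable_of_n14At_n18At_n22At (R : RateCarriers N) (h14 : N14At R.ne1) (h18 : N18At R.u3)
    (h22 : N22At R.u3)
    -- the consumer's ledger and ONE census at N14's rate
    (hL : ScaleLedger l₀ T Bad F ν F' ν' wf sc bA bB ΔA ΔB w) (wt : ℕ → ι → D → ℝ)
    (hwt : ∀ K τ, ∀ X ∈ wf K τ, 0 ≤ wt K τ X) {Cw : ℝ} (hCw : 0 ≤ Cw)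
    (hM : ∀ K, ∀ τ ∈ T K, Multiplicity (wf K τ) (sc K) (wt K τ) Cw vol R.ne1.Λ K)
    -- run A and run B read as two parameters of N14's dressed tower (n14-a's one-run identifications, verbatim)
    (pA : ℕ → ℝ → ℝ → R.ne1.P) (KA : ℕ → ℕ)
    (βA : ∀ (K : ℕ) (t : ℝ) (τ : ι) (s : ℝ), D → (R.ne1.𝒯.B (pA K t s) (KA K)).Birth)
    (hscA : ∀ K t τ s, ∀ X ∈ wf K τ, KA K - (R.ne1.𝒯.B (pA K t s) (KA K)).birthScale (βA K t τ s X) = K - sc K X)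
    (hdomA : ∀ K (t : ℝ), |t| ≤ l₀ → ∀ τ ∈ T K \ Bad K t, ∀ s : ℝ, |s| ≤ l₀ → ∀ X ∈ wf K τ,
      |ΔA K t τ s X| ≤ (R.ne1.𝒯.B (pA K t s) (KA K)).size (βA K t τ s X) (KA K) * wt K τ X)
    (pB : ℕ → ℝ → ℝ → R.ne1.P) (KB : ℕ → ℕ)
    (βB : ∀ (K : ℕ) (t : ℝ) (τ : ι) (s : ℝ), D → (R.ne1.𝒯.B (pB K t s) (KB K)).Birth)
    (hscB : ∀ K t τ s, ∀ X ∈ wf K τ, KB K - (R.ne1.𝒯.B (pB K t s) (KB K)).birthScale (βB K t τ s X) = K - sc K X)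
    (hdomB : ∀ K (t : ℝ), |t| ≤ l₀ → ∀ τ ∈ T K \ Bad K t, ∀ s : ℝ, |s| ≤ l₀ → ∀ X ∈ wf K τ,
      |ΔB K t τ s X| ≤ (R.ne1.𝒯.B (pB K t s) (KB K)).size (βB K t τ s X) (KB K) * wt K τ X)
    -- the two-run reading on node U3's carriers (§2's binders)
    (bsel : (ℕ → ℝ) → ℝ) (hb : ∀ s ∈ R.u3.W, 0 < bsel s ∧ bsel s ≤ R.u3.γ)
    {CU : (ℕ → ℝ) → ℕ → ℝ} (hU : LipBackground R.u3.EA R.u3.W R.u3.κ CU)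
    (hθ : 0 ≤ R.u3.θ) (hC₅ : 0 ≤ R.u3.C₅) (hκ : 0 ≤ R.u3.κ) {ρ : ℝ} (hθρ : R.u3.θ ≤ ρ) (hρ0 : 0 < ρ) (hρ1 : ρ < 1)
    (hρΛ : ρ ≤ R.ne1.Λ)
    (δ : ∀ (K : ℕ) (t : ℝ) (τ : ι) (s : ℝ), D → R.u3.C.Dom)
    (hδ : ∀ K t τ s, ∀ X ∈ wf K τ, R.u3.C.scale (δ K t τ s X) = sc K X)
    (gA gB : ℕ → ℕ → ℝ) (hgA : ∀ K, gA K ∈ R.u3.W) (hgB : ∀ K, gB K ∈ R.u3.W) (hCU : ∀ K j, 0 ≤ CU (gA K) j)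
    (UA : ∀ (K : ℕ) (t : ℝ) (τ : ι) (s : ℝ), D → R.u3.C.BgA) (UB : ∀ (K : ℕ) (t : ℝ) (τ : ι) (s : ℝ), D → R.u3.C.BgB)
    (hdom : ∀ K (t : ℝ), |t| ≤ l₀ → ∀ τ ∈ T K \ Bad K t, ∀ s : ℝ, |s| ≤ l₀ → ∀ X ∈ wf K τ,
      |ΔB K t τ s X - ΔA K t τ s X| ≤
        wt K τ X * |R.u3.EA (gA K) (UA K t τ s X) (δ K t τ s X)
          - R.u3.EB (bsel (gB K)) (gB K) (UB K t τ s X) (δ K t τ s X)|)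
    {a b : ℝ}
    (harg : ∀ K (t : ℝ), |t| ≤ l₀ → ∀ τ ∈ T K \ Bad K t, ∀ s : ℝ, |s| ≤ l₀ → ∀ X ∈ wf K τ,
      CU (gA K) (sc K X) * R.u3.C.gauge (UA K t τ s X) (R.u3.C.transport (UB K t τ s X)) ≤ a * ρ ^ sc K X)
    (hcpl : ∀ K, ∀ j ≤ K, ∑ i ∈ range j, R.u3.Λ j i * |gA K i - gB K i| ≤ b * ρ ^ j)
    (ha0 : 0 ≤ a) (hb0 : 0 ≤ b) (hvol : 0 ≤ vol) (hws : Summable w) :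
    ∃ η : ℕ → ℝ, TiltedMeanMatching l₀ T Bad F ν F' ν' η ∧ Summable η :=
  YMDAG.N14.tiltedMeanMatching_summable_of_n14 h14 hL wt hwt hM hCw pA KA βA hscA hdomA pB KB βB hscB hdomB
    (youngInfluenceRate_of_n18At_n22At R.u3 h18 h22 bsel hb hU hθ hC₅ hκ hθρ wt hwt hM δ hδ gA gB hgA hgB hCU UA UB hdom
      harg hcpl ha0 hb0)
    hvol hρ0 hρ1 hρΛ hws

/-- **`RatesAt D R` READ AT N14 · N18 · N22 ⇒ THE RESIDUAL BINDER WITH A SUMMABLE MAJORANT** [bookkeeping]: the same with K4's conclusion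
for one string, `RatesAt D R`, consumed at `.1` (N14), `.2.2.2.2.1` (N18), `.2.2.2.2.2` (N22) BY NAME — the road-(ii) analogue of
`N19RateEdgeByName.rateEdge_of_linkReading_byName`.  `N15At`, `N16At`, `N17At` are not consumed (N16 ∕ N17 stand behind the two displayed
brackets). [folklore] -/
theorem tiltedMeanMatching_summable_of_ratesAt {Fam : T4Continuum.T4Family} (Dt : YMDAG.UVSplit.Datum Fam N) (R : RateCarriers N)
    (hrates : RatesAt Dt R)
    (hL : ScaleLedger l₀ T Bad F ν F' ν' wf sc bA bB ΔA ΔB w) (wt : ℕ → ι → D → ℝ)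
    (hwt : ∀ K τ, ∀ X ∈ wf K τ, 0 ≤ wt K τ X) {Cw : ℝ} (hCw : 0 ≤ Cw)
    (hM : ∀ K, ∀ τ ∈ T K, Multiplicity (wf K τ) (sc K) (wt K τ) Cw vol R.ne1.Λ K)
    (pA : ℕ → ℝ → ℝ → R.ne1.P) (KA : ℕ → ℕ)
    (βA : ∀ (K : ℕ) (t : ℝ) (τ : ι) (s : ℝ), D → (R.ne1.𝒯.B (pA K t s) (KA K)).Birth)
    (hscA : ∀ K t τ s, ∀ X ∈ wf K τ, KA K - (R.ne1.𝒯.B (pA K t s) (KA K)).birthScale (βA K t τ s X) = K - sc K X)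
    (hdomA : ∀ K (t : ℝ), |t| ≤ l₀ → ∀ τ ∈ T K \ Bad K t, ∀ s : ℝ, |s| ≤ l₀ → ∀ X ∈ wf K τ,
      |ΔA K t τ s X| ≤ (R.ne1.𝒯.B (pA K t s) (KA K)).size (βA K t τ s X) (KA K) * wt K τ X)
    (pB : ℕ → ℝ → ℝ → R.ne1.P) (KB : ℕ → ℕ)
    (βB : ∀ (K : ℕ) (t : ℝ) (τ : ι) (s : ℝ), D → (R.ne1.𝒯.B (pB K t s) (KB K)).Birth)
    (hscB : ∀ K t τ s, ∀ X ∈ wf K τ, KB K - (R.ne1.𝒯.B (pB K t s) (KB K)).birthScale (βB K t τ s X) = K - sc K X)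
    (hdomB : ∀ K (t : ℝ), |t| ≤ l₀ → ∀ τ ∈ T K \ Bad K t, ∀ s : ℝ, |s| ≤ l₀ → ∀ X ∈ wf K τ,
      |ΔB K t τ s X| ≤ (R.ne1.𝒯.B (pB K t s) (KB K)).size (βB K t τ s X) (KB K) * wt K τ X)
    (bsel : (ℕ → ℝ) → ℝ) (hb : ∀ s ∈ R.u3.W, 0 < bsel s ∧ bsel s ≤ R.u3.γ)
    {CU : (ℕ → ℝ) → ℕ → ℝ} (hU : LipBackground R.u3.EA R.u3.W R.u3.κ CU)
    (hθ : 0 ≤ R.u3.θ) (hC₅ : 0 ≤ R.u3.C₅) (hκ : 0 ≤ R.u3.κ) {ρ : ℝ} (hθρ : R.u3.θ ≤ ρ) (hρ0 : 0 < ρ) (hρ1 : ρ < 1)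
    (hρΛ : ρ ≤ R.ne1.Λ)
    (δ : ∀ (K : ℕ) (t : ℝ) (τ : ι) (s : ℝ), D → R.u3.C.Dom)
    (hδ : ∀ K t τ s, ∀ X ∈ wf K τ, R.u3.C.scale (δ K t τ s X) = sc K X)
    (gA gB : ℕ → ℕ → ℝ) (hgA : ∀ K, gA K ∈ R.u3.W) (hgB : ∀ K, gB K ∈ R.u3.W) (hCU : ∀ K j, 0 ≤ CU (gA K) j)
    (UA : ∀ (K : ℕ) (t : ℝ) (τ : ι) (s : ℝ), D → R.u3.C.BgA) (UB : ∀ (K : ℕ) (t : ℝ) (τ : ι) (s : ℝ), D → R.u3.C.BgB)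
    (hdom : ∀ K (t : ℝ), |t| ≤ l₀ → ∀ τ ∈ T K \ Bad K t, ∀ s : ℝ, |s| ≤ l₀ → ∀ X ∈ wf K τ,
      |ΔB K t τ s X - ΔA K t τ s X| ≤
        wt K τ X * |R.u3.EA (gA K) (UA K t τ s X) (δ K t τ s X)
          - R.u3.EB (bsel (gB K)) (gB K) (UB K t τ s X) (δ K t τ s X)|)
    {a b : ℝ}
    (harg : ∀ K (t : ℝ), |t| ≤ l₀ → ∀ τ ∈ T K \ Bad K t, ∀ s : ℝ, |s| ≤ l₀ → ∀ X ∈ wf K τ,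
      CU (gA K) (sc K X) * R.u3.C.gauge (UA K t τ s X) (R.u3.C.transport (UB K t τ s X)) ≤ a * ρ ^ sc K X)
    (hcpl : ∀ K, ∀ j ≤ K, ∑ i ∈ range j, R.u3.Λ j i * |gA K i - gB K i| ≤ b * ρ ^ j)
    (ha0 : 0 ≤ a) (hb0 : 0 ≤ b) (hvol : 0 ≤ vol) (hws : Summable w) :
    ∃ η : ℕ → ℝ, TiltedMeanMatching l₀ T Bad F ν F' ν' η ∧ Summable η :=
  tiltedMeanMatching_summable_of_n14At_n18At_n22At R hrates.1 hrates.2.2.2.2.1 hrates.2.2.2.2.2 hL wt hwt hCw hM pA KA βA hscA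
    hdomA pB KB βB hscB hdomB bsel hb hU hθ hC₅ hκ hθρ hρ0 hρ1 hρΛ δ hδ gA gB hgA hgB hCU UA UB hdom harg hcpl ha0 hb0 hvol hws

end Capstone

/-! ## §4 Guard: §1's binder list is jointly inhabited, with a non-trivial rate -/

section Toy

/-- **§1 FIRES NON-VACUOUSLY** [decided toy].  Toy U3 carriers: domains = the scales themselves (`Dom = ℕ`, `scale = id`, tree length `0`),
one-point backgrounds, zero gauge, identity transport; run A's functional `0`, run B's `−c·θ^{scale X}` (`c, θ ≥ 0`): NE5 holds with
`(θ, c)` and is ATTAINED, NE9 (moduli `0`) and the bracket (T) (`CU = 0`) hold trivially; the ledger has one class, slots `0, …, K` with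
`sc = id`, run A's influences `0`, run B's `c·θ^X`, unit weights — the two-run domination holds WITH EQUALITY, both brackets at `a = b = 0`,
the census at `Cw = vol = Λ = 1`; §1 returns `YoungInfluenceRate 1 T ∅ wf id 0 (c·θ^X) 1 (1·(0+0+c)) θ 1`, i.e. on the scale-`j` slice
`c·θ^j ≤ 1·((1·(0+0+c))·(θ^j·1^{K−j}))` — the rate is NE5's, not fiat.  No `def`: the carriers are a structure literal. [folklore] -/
theorem youngInfluenceRate_toy {c θ : ℝ} (hc : 0 ≤ c) (hθ : 0 ≤ θ) :
    YoungInfluenceRate (ι := Unit) (D := ℕ) 1 (fun _ => {()}) (fun _ _ => ∅) (fun K _ => range (K + 1)) (fun _ X => X)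
      (fun _ _ _ _ _ => (0 : ℝ)) (fun _ _ _ _ X => c * θ ^ X) 1 (1 * (0 + 0 + c)) θ 1 := by
  refine youngInfluenceRate_of_u3Letters
    (C := { Dom := ℕ, scale := fun j => j, d := fun _ => 0, d_nonneg := fun _ => le_rfl, BgA := Unit, BgB := Unit,
            gauge := fun _ _ => 0, gauge_nonneg := fun _ _ => le_rfl, transport := fun U => U })
    (D := ℕ) (W := Set.univ) (EA := fun _ _ _ => (0 : ℝ))
    (EB := fun _ _ (X : ℕ) => -(c * θ ^ X)) (κ := 0) (Λ9 := fun _ _ => 0) (CU := fun _ _ => 0)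
    ?_ ?_ ?_ le_rfl (fun _ _ _ => 1) (fun _ _ _ _ => zero_le_one) ?_
    (fun _ _ _ _ (X : ℕ) => X) (fun _ _ _ _ _ _ => rfl) (fun _ _ => 1) (fun _ _ => 1) (fun _ => Set.mem_univ _)
    (fun _ => Set.mem_univ _) (fun _ _ => le_rfl) (fun _ _ _ _ _ => ()) (fun _ _ _ _ _ => ()) ?_ (a := 0) (b := 0) ?_ ?_
    le_rfl le_rfl hc hθ
  · -- NE9 with zero moduli: run A's functional is constant in the couplings
    intro g _ g' _ U X
    simp
  · -- the bracket (T) with `CU = 0`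
    intro g _ U U' X
    simp
  · -- NE5, attained: |0 − (−cθ^X)| = c·θ^X·e^0
    intro g _ U X
    show |(0 : ℝ) - (-(c * θ ^ (X : ℕ)))| ≤ c * θ ^ (X : ℕ) * Real.exp (-(0 * (0 : ℝ)))
    rw [mul_zero, neg_zero, Real.exp_zero, mul_one, zero_sub, neg_neg, abs_of_nonneg (mul_nonneg hc (pow_nonneg hθ _))]
  · -- the census: one slot per scale, `1 ≤ 1·1·1^{K−j}`
    intro K τ _ j hj
    have hfilter : ((range (K + 1)).filter fun X => X = j) = {j} := by
      ext X; simp only [mem_filter, mem_range, mem_singleton]; omega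
    show ∑ X ∈ (range (K + 1)).filter (fun X => X = j), (1 : ℝ) ≤ 1 * 1 * 1 ^ (K - j)
    rw [one_pow, mul_one, mul_one, hfilter, sum_singleton]
  · -- the two-run domination, with equality
    intro K t _ τ _ s _ X _
    show |c * θ ^ X - 0| ≤ 1 * |(0 : ℝ) - (-(c * θ ^ X))|
    rw [sub_zero, zero_sub, neg_neg, one_mul]
  · -- the argument bracket at `a = 0`
    intro K t _ τ _ s _ X _
    simp
  · -- the coupling bracket at `b = 0`
    intro K j _
    simp

end Toy

end YMDAG.N14YoungRate

end
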